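import Mathlib

/-!
# The IMS localisation formula in a discrete (link) index and its lower-bound corollary

Helpers for the heart `stub_lipschitzCovarianceDecay` of line `Sketch` (card `one-form-witten-ims`) of crux
stmt-QuantumFields-8761 (`Summit.QuantumFields.YangMills.Theses.EquipartitionCriticality.LatticeGapLargeBeta`):
the finite-dimensional core of "block bottoms ⇒ global bottom" for a real matrix `A` (a Galerkin
truncation of the Witten 1-form operator, indexed by link components) and a quadratic partition of unity
`∑_b j_b(i)² = 1` in the index:

* `linkIMS_identity` — `∑_b ⟨j_b ω, A j_b ω⟩ = ⟨ω, A ω⟩ − ½ ∑_b ∑_{i,k} (j_b i − j_b k)² ω_i A_{ik} ω_k`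
  (Hislop–Sigal (19.54) in finite-difference form);
* `linkIMS_lowerBound` — if every block is bounded below by `σ` on vectors supported in `{j_b ≠ 0}` and
  the localisation error is at most `2ρ‖ω‖²`, then `A ≥ σ − ρ` (the card's `LinkIMSLowerBound`).

References: P. D. Hislop, I. M. Sigal, *Introduction to Spectral Theory* (Springer 1996), (19.54);
B. Simon, Ann. Inst. H. Poincaré A 38 (1983) 295 (IMS localisation).
-/

open scoped BigOperators
open Finset Matrix

namespace Summit.QuantumFields.YangMills.Theorems.LatticeGapLargeBeta.WittenIMS

variable {n B : Type*} [Fintype n] [Fintype B]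

omit [Fintype n] in
/-- Pointwise form of the partition of unity: `∑_b j_b(i) j_b(k) = 1 − ½ ∑_b (j_b(i) − j_b(k))²`.
[folklore] -/
theorem sum_mul_eq_one_sub_half_sum_sq (j : B → n → ℝ) (hpart : ∀ i, ∑ b, j b i ^ 2 = 1)
    (i k : n) : ∑ b, j b i * j b k = 1 - (1 / 2) * ∑ b, (j b i - j b k) ^ 2 := by
  have h : ∑ b, (j b i - j b k) ^ 2 = ∑ b, j b i ^ 2 + ∑ b, j b k ^ 2 - 2 * ∑ b, j b i * j b k := by
    rw [Finset.mul_sum, ← Finset.sum_add_distrib, ← Finset.sum_sub_distrib]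
    exact Finset.sum_congr rfl fun b _ => by ring
  rw [h, hpart i, hpart k]
  ring

/-- **The IMS localisation formula in a discrete index** (Hislop–Sigal (19.54), finite-difference form):
for a real matrix `A` and a quadratic partition of unity `∑_b j_b(i)² = 1`,
`∑_b ⟨j_b ω, A (j_b ω)⟩ = ⟨ω, A ω⟩ − ½ ∑_b ∑_i ∑_k (j_b i − j_b k)² ω_i A_{ik} ω_k`.
(Hislop–Sigal 1996, (19.54); Simon 1983). [folklore] -/
theorem linkIMS_identity (A : Matrix n n ℝ) (j : B → n → ℝ) (hpart : ∀ i, ∑ b, j b i ^ 2 = 1)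
    (ω : n → ℝ) :
    ∑ b, (fun i => j b i * ω i) ⬝ᵥ A.mulVec (fun i => j b i * ω i) =
      ω ⬝ᵥ A.mulVec ω - (1 / 2) * ∑ b, ∑ i, ∑ k, (j b i - j b k) ^ 2 * (ω i * A i k * ω k) := by
  -- expand both sides into triple sums
  have hL : ∀ b, (fun i => j b i * ω i) ⬝ᵥ A.mulVec (fun i => j b i * ω i) =
      ∑ i, ∑ k, j b i * j b k * (ω i * A i k * ω k) := by
    intro b
    simp only [dotProduct, mulVec, Finset.mul_sum]
    exact Finset.sum_congr rfl fun i _ => Finset.sum_congr rfl fun k _ => by ring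
  have hR : ω ⬝ᵥ A.mulVec ω = ∑ i, ∑ k, ω i * A i k * ω k := by
    simp only [dotProduct, mulVec, Finset.mul_sum]
    exact Finset.sum_congr rfl fun i _ => Finset.sum_congr rfl fun k _ => by ring
  simp_rw [hL, hR]
  rw [Finset.sum_comm]
  have h2 : ∑ b, ∑ i, ∑ k, (j b i - j b k) ^ 2 * (ω i * A i k * ω k) =
      ∑ i, ∑ k, (∑ b, (j b i - j b k) ^ 2) * (ω i * A i k * ω k) := by
    rw [Finset.sum_comm]
    refine Finset.sum_congr rfl fun i _ => ?_
    rw [Finset.sum_comm]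
    refine Finset.sum_congr rfl fun k _ => ?_
    rw [Finset.sum_mul]
  rw [h2, Finset.mul_sum, ← Finset.sum_sub_distrib]
  refine Finset.sum_congr rfl fun i _ => ?_
  rw [Finset.sum_comm, Finset.mul_sum, ← Finset.sum_sub_distrib]
  refine Finset.sum_congr rfl fun k _ => ?_
  rw [← Finset.sum_mul, sum_mul_eq_one_sub_half_sum_sq j hpart i k]
  ring

/-- `∑_b ‖j_b ω‖² = ‖ω‖²` for a quadratic partition of unity. [folklore] -/
theorem sum_dotProduct_loc_eq (j : B → n → ℝ) (hpart : ∀ i, ∑ b, j b i ^ 2 = 1) (ω : n → ℝ) :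
    ∑ b, (fun i => j b i * ω i) ⬝ᵥ (fun i => j b i * ω i) = ω ⬝ᵥ ω := by
  simp only [dotProduct]
  rw [Finset.sum_comm]
  refine Finset.sum_congr rfl fun i _ => ?_
  have : ∑ b, j b i * ω i * (j b i * ω i) = (∑ b, j b i ^ 2) * (ω i * ω i) := by
    rw [Finset.sum_mul]
    exact Finset.sum_congr rfl fun b _ => by ring
  rw [this, hpart i, one_mul]

/-- **IMS lower bound in the link index** (the card's `LinkIMSLowerBound`): if every block `b` of a
quadratic partition of unity bounds `A` below by `σ` on vectors supported in `{i | j_b i ≠ 0}`, and the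
localisation error satisfies `|∑_b ∑_{i,k} (j_b i − j_b k)² ω_i A_{ik} ω_k| ≤ 2ρ‖ω‖²`, then
`⟨ω, A ω⟩ ≥ (σ − ρ)‖ω‖²` for every `ω`.  Three lines from `linkIMS_identity` and
`∑_b ‖j_b ω‖² = ‖ω‖²`. (Hislop–Sigal 1996, (19.54); Simon 1983). [folklore] -/
theorem linkIMS_lowerBound (A : Matrix n n ℝ) (j : B → n → ℝ) (σ ρ : ℝ)
    (hpart : ∀ i, ∑ b, j b i ^ 2 = 1)
    (hblock : ∀ (b : B) (ω : n → ℝ), (∀ i, j b i = 0 → ω i = 0) → σ * (ω ⬝ᵥ ω) ≤ ω ⬝ᵥ A.mulVec ω)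
    (herr : ∀ ω : n → ℝ, |∑ b, ∑ i, ∑ k, (j b i - j b k) ^ 2 * (ω i * A i k * ω k)| ≤ 2 * ρ * (ω ⬝ᵥ ω))
    (ω : n → ℝ) : (σ - ρ) * (ω ⬝ᵥ ω) ≤ ω ⬝ᵥ A.mulVec ω := by
  have hid := linkIMS_identity A j hpart ω
  have hsum : ∑ b, σ * ((fun i => j b i * ω i) ⬝ᵥ (fun i => j b i * ω i)) ≤
      ∑ b, (fun i => j b i * ω i) ⬝ᵥ A.mulVec (fun i => j b i * ω i) :=
    Finset.sum_le_sum fun b _ => hblock b _ fun i hi => by simp [hi]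
  rw [← Finset.mul_sum, sum_dotProduct_loc_eq j hpart ω, hid] at hsum
  have he := (abs_le.1 (herr ω)).1
  nlinarith [hsum, he]

end Summit.QuantumFields.YangMills.Theorems.LatticeGapLargeBeta.WittenIMS
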